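import Mathlib
import Summits.SmoothPoincare4.SmoothPoincare4.Theorems.SullivanDualWitnessChargeStubBubbleConfinementSubharmonic
import HarnessLib

/-!
# Crux `HyperbolicEnd` (stmt-SmoothPoincare4-7825), line `Sketch` — the certificate cone is convex
# (flat toolbox for the filling stub `stub_certificateFill`, K1)

In the certificate interface of the line a triple `(J, F, c)` on a region `A ⊆ ℝ⁴` is a
CERTIFICATE if along every local `J`-holomorphic map `g : U → A` (`U ⊆ ℂ` open) the density
`λ = F(g, ∂ₓg)` is `C²` on `U` with `2c λ³ ≤ λ Δλ - ((∂ₓλ)² + (∂_yλ)²)` (Gauss curvature `≤ -c`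
in Ahlfors' form, vanishing allowed). We prove that for FIXED `J` the certifying `F ≥ 0` form a
convex cone up to halving the constant: if `(J, F₁, c)` and `(J, F₂, c)` are certificates on `A`
with `F₁, F₂ ≥ 0` there and `c ≥ 0`, then `(J, F₁ + F₂, c/2)` is a certificate on `A`
(`flatCertificate_add`). This is the classical fact that the sum of two pseudo-metrics of
curvature `≤ -k` has curvature `≤ -k/2` (Grauert–Reckziegel; Kobayashi, *Hyperbolic complex
spaces*, Lemma 2.3.x), here in the `C²`, zeros-allowed form: with `λ = λ₁ + λ₂`,
`λΔλ - |∇λ|² = Σᵢ(λᵢΔλᵢ - |∇λᵢ|²) + λ₁Δλ₂ + λ₂Δλ₁ - 2∇λ₁·∇λ₂`, and where `λ₁, λ₂ > 0`,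
`λ₂Δλ₁ ≥ (λ₂/λ₁)(2cλ₁³ + |∇λ₁|²)`, `λ₁Δλ₂ ≥ (λ₁/λ₂)(2cλ₂³ + |∇λ₂|²)`, the gradient terms
combine to `|√(λ₂/λ₁)∇λ₁ - √(λ₁/λ₂)∇λ₂|² ≥ 0` and the cubic terms to
`2c(λ₁+λ₂)(λ₁²+λ₂²) ≥ c(λ₁+λ₂)³` (`pointwise_sum_ineq`, cleared of denominators); at a zero
of `λᵢ ≥ 0` the gradient vanishes and the Laplacian is `≥ 0` (second-derivative test,
`laplacian_nonneg_of_isLocalMin`). It is the tool by which a filling interpolates, for a fixed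
almost complex structure, between two certifying densities (partition of unity in `F`).

References: H. Grauert, H. Reckziegel, Math. Z. 89 (1965) 108–125; S. Kobayashi, *Hyperbolic
complex spaces* (1998), Ch. 2; L. Ahlfors, Trans. AMS 43 (1938).
-/

noncomputable section

-- the prescribed crux namespace repeats the component `SmoothPoincare4`
set_option linter.dupNamespace false

open scoped Topology ContDiff
open Laplacian Set Filter InnerProductSpace
open Summit.SmoothPoincare4.SmoothPoincare4.Theorems.WitnessCharge.PencilIncompleteness

namespace Summit.SmoothPoincare4.SmoothPoincare4.Cruxes.HyperbolicEnd.Sketch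

/-- **Second-derivative test, minimum form**: at a local minimum of a `C²` function
`f : ℂ → ℝ` the Laplacian is `≥ 0` (apply `laplacian_nonpos_of_isLocalMax` to `-f`). -/
theorem laplacian_nonneg_of_isLocalMin {f : ℂ → ℝ} {z : ℂ} (hf : ContDiffAt ℝ 2 f z)
    (h : IsLocalMin f z) : 0 ≤ Δ f z := by
  have hneg : Δ (-f) z ≤ 0 := laplacian_nonpos_of_isLocalMax hf.neg h.neg
  rw [laplacian_neg] at hneg
  simpa using hneg

/-- **The pointwise inequality behind `flatCertificate_add`**, denominators cleared. For reals
`a, b ≥ 0` (the two densities), `La, Lb` (their Laplacians), gradients `(x₁, y₁)`, `(x₂, y₂)`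
and `c ≥ 0` with `2c a³ ≤ a La - (x₁² + y₁²)`, `2c b³ ≤ b Lb - (x₂² + y₂²)`, and the
degenerate information `a = 0 → x₁ = 0 ∧ y₁ = 0 ∧ 0 ≤ La` (resp. for `b`), the sum satisfies
`2(c/2)(a+b)³ ≤ (a+b)(La+Lb) - ((x₁+x₂)² + (y₁+y₂)²)`. Proof: if `a, b > 0`, multiply the target
by `ab` and use `b(a+b)·(aLa) + a(a+b)·(bLb) - ab|∇₁+∇₂|² - abc(a+b)³ ≥ abc(a+b)(a-b)² +
(bx₁-ax₂)² + (by₁-ay₂)²`; if `a = 0` the target is `b Lb + b La - |∇₂|² ≥ c b³`. -/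
theorem pointwise_sum_ineq {a b La Lb x₁ y₁ x₂ y₂ c : ℝ} (ha : 0 ≤ a) (hb : 0 ≤ b) (hc : 0 ≤ c)
    (h₁ : 2 * c * a ^ 3 ≤ a * La - (x₁ ^ 2 + y₁ ^ 2))
    (h₂ : 2 * c * b ^ 3 ≤ b * Lb - (x₂ ^ 2 + y₂ ^ 2))
    (h₁0 : a = 0 → x₁ = 0 ∧ y₁ = 0 ∧ 0 ≤ La) (h₂0 : b = 0 → x₂ = 0 ∧ y₂ = 0 ∧ 0 ≤ Lb) :
    2 * (c / 2) * (a + b) ^ 3 ≤ (a + b) * (La + Lb) - ((x₁ + x₂) ^ 2 + (y₁ + y₂) ^ 2) := by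
  rcases ha.eq_or_lt with h0 | hapos
  · obtain ⟨hx, hy, hLa⟩ := h₁0 h0.symm
    subst hx; subst hy
    rw [← h0] at h₁ ⊢
    have hbLa : 0 ≤ b * La := mul_nonneg hb hLa
    nlinarith [h₂, hbLa, pow_nonneg hb 3]
  rcases hb.eq_or_lt with h0 | hbpos
  · obtain ⟨hx, hy, hLb⟩ := h₂0 h0.symm
    subst hx; subst hy
    rw [← h0] at h₂ ⊢
    have haLb : 0 ≤ a * Lb := mul_nonneg ha hLb
    nlinarith [h₁, haLb, pow_nonneg ha 3]
  -- both positive: clear denominators with the multiplier `a * b > 0`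
  have hab : 0 < a * b := mul_pos hapos hbpos
  have key : 0 ≤ a * b * ((a + b) * (La + Lb) - ((x₁ + x₂) ^ 2 + (y₁ + y₂) ^ 2)
      - c * (a + b) ^ 3) := by
    have e₁ := mul_le_mul_of_nonneg_left h₁ (mul_nonneg hb (add_nonneg ha hb))
    have e₂ := mul_le_mul_of_nonneg_left h₂ (mul_nonneg ha (add_nonneg ha hb))
    have e₃ : 0 ≤ a * b * c * (a + b) * (a - b) ^ 2 :=
      mul_nonneg (mul_nonneg (mul_nonneg hab.le hc) (add_nonneg ha hb)) (sq_nonneg _)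
    nlinarith [e₁, e₂, e₃, sq_nonneg (b * x₁ - a * x₂), sq_nonneg (b * y₁ - a * y₂)]
  have key' : 0 ≤ (a + b) * (La + Lb) - ((x₁ + x₂) ^ 2 + (y₁ + y₂) ^ 2) - c * (a + b) ^ 3 :=
    nonneg_of_mul_nonneg_right (by simpa [mul_comm] using key) hab
  linarith

/-- **Sum of certificates (convexity of the certificate cone for fixed `J`).** If `(J, F₁, c)`
and `(J, F₂, c)` are certificates on `A ⊆ ℝ⁴` (along every local `J`-holomorphic `g : U → A`
the densities `λᵢ = Fᵢ(g, ∂ₓg)` are `C²` on `U` with `2cλᵢ³ ≤ λᵢΔλᵢ - |∇λᵢ|²`), with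
`F₁, F₂ ≥ 0` on `A` and `c ≥ 0`, then `(J, F₁ + F₂, c/2)` is a certificate on `A`: the
density of the sum is `λ₁ + λ₂`, `C²` on `U`; its Laplacian and gradient are the sums
(`ContDiffAt.laplacian_add`, `fderiv_add`); at a zero of `λᵢ` on the open `U` the gradient of
`λᵢ` vanishes and `Δλᵢ ≥ 0` (`λᵢ ≥ 0` has a local minimum there); conclude by
`pointwise_sum_ineq`. Binder form of the registered `flatCertificate_add`.
[Grauert–Reckziegel 1965; Kobayashi 1998, Ch. 2] -/
theorem flatCertificate_add'
    {J : EuclideanSpace ℝ (Fin 4) → EuclideanSpace ℝ (Fin 4) →L[ℝ] EuclideanSpace ℝ (Fin 4)}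
    {F₁ F₂ : EuclideanSpace ℝ (Fin 4) → EuclideanSpace ℝ (Fin 4) → ℝ} {c : ℝ}
    {A : Set (EuclideanSpace ℝ (Fin 4))} (hc : 0 ≤ c)
    (hF₁ : ∀ x ∈ A, ∀ v, 0 ≤ F₁ x v) (hF₂ : ∀ x ∈ A, ∀ v, 0 ≤ F₂ x v)
    (h₁ : ∀ (U : Set ℂ) (g : ℂ → EuclideanSpace ℝ (Fin 4)), IsOpen U →
      ContDiffOn ℝ ∞ g U →
      (∀ z ∈ U, ∀ ζ : ℂ,
        fderiv ℝ g z (Complex.I * ζ) = J (g z) (fderiv ℝ g z ζ)) →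
      (∀ z ∈ U, g z ∈
        A) →
      ContDiffOn ℝ 2 (fun w => F₁ (g w) (fderiv ℝ g w 1)) U ∧
      ∀ z ∈ U, 2 * c * (F₁ (g z) (fderiv ℝ g z 1)) ^ 3 ≤
        F₁ (g z) (fderiv ℝ g z 1) * (Δ (fun w => F₁ (g w) (fderiv ℝ g w 1))) z -
          ((fderiv ℝ (fun w => F₁ (g w) (fderiv ℝ g w 1)) z 1) ^ 2 +
            (fderiv ℝ (fun w => F₁ (g w) (fderiv ℝ g w 1)) z Complex.I) ^ 2))
    (h₂ : ∀ (U : Set ℂ) (g : ℂ → EuclideanSpace ℝ (Fin 4)), IsOpen U →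
      ContDiffOn ℝ ∞ g U →
      (∀ z ∈ U, ∀ ζ : ℂ,
        fderiv ℝ g z (Complex.I * ζ) = J (g z) (fderiv ℝ g z ζ)) →
      (∀ z ∈ U, g z ∈
        A) →
      ContDiffOn ℝ 2 (fun w => F₂ (g w) (fderiv ℝ g w 1)) U ∧
      ∀ z ∈ U, 2 * c * (F₂ (g z) (fderiv ℝ g z 1)) ^ 3 ≤
        F₂ (g z) (fderiv ℝ g z 1) * (Δ (fun w => F₂ (g w) (fderiv ℝ g w 1))) z -
          ((fderiv ℝ (fun w => F₂ (g w) (fderiv ℝ g w 1)) z 1) ^ 2 +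
            (fderiv ℝ (fun w => F₂ (g w) (fderiv ℝ g w 1)) z Complex.I) ^ 2)) :
    ∀ (U : Set ℂ) (g : ℂ → EuclideanSpace ℝ (Fin 4)), IsOpen U →
      ContDiffOn ℝ ∞ g U →
      (∀ z ∈ U, ∀ ζ : ℂ,
        fderiv ℝ g z (Complex.I * ζ) = J (g z) (fderiv ℝ g z ζ)) →
      (∀ z ∈ U, g z ∈
        A) →
      ContDiffOn ℝ 2 (fun w => (fun x v => F₁ x v + F₂ x v) (g w) (fderiv ℝ g w 1)) U ∧
      ∀ z ∈ U, 2 * (c / 2) * ((fun x v => F₁ x v + F₂ x v) (g z) (fderiv ℝ g z 1)) ^ 3 ≤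
        (fun x v => F₁ x v + F₂ x v) (g z) (fderiv ℝ g z 1)
          * (Δ (fun w => (fun x v => F₁ x v + F₂ x v) (g w) (fderiv ℝ g w 1))) z -
          ((fderiv ℝ (fun w => (fun x v => F₁ x v + F₂ x v) (g w) (fderiv ℝ g w 1)) z 1) ^ 2 +
            (fderiv ℝ (fun w => (fun x v => F₁ x v + F₂ x v) 
              (g w) (fderiv ℝ g w 1)) z Complex.I) ^ 2) := by
  intro U g hU hg hhol hgA
  obtain ⟨hC₁, hI₁⟩ := h₁ U g hU hg hhol hgA
  obtain ⟨hC₂, hI₂⟩ := h₂ U g hU hg hhol hgA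
  set l₁ : ℂ → ℝ := fun w => F₁ (g w) (fderiv ℝ g w 1) with hl₁
  set l₂ : ℂ → ℝ := fun w => F₂ (g w) (fderiv ℝ g w 1) with hl₂
  have hsum : (fun w => (fun x v => F₁ x v + F₂ x v) (g w) (fderiv ℝ g w 1)) = l₁ + l₂ := by
    funext w; simp [hl₁, hl₂]
  rw [hsum]
  refine ⟨hC₁.add hC₂, fun z hz => ?_⟩
  have hUz : U ∈ 𝓝 z := hU.mem_nhds hz
  have hc₁ : ContDiffAt ℝ 2 l₁ z := hC₁.contDiffAt hUz
  have hc₂ : ContDiffAt ℝ 2 l₂ z := hC₂.contDiffAt hUz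
  have hd₁ : DifferentiableAt ℝ l₁ z := hc₁.differentiableAt (by norm_num)
  have hd₂ : DifferentiableAt ℝ l₂ z := hc₂.differentiableAt (by norm_num)
  have hlap : Δ (l₁ + l₂) z = Δ l₁ z + Δ l₂ z := hc₁.laplacian_add hc₂
  have hfd : fderiv ℝ (l₁ + l₂) z = fderiv ℝ l₁ z + fderiv ℝ l₂ z := fderiv_add hd₁ hd₂
  -- non-negativity of the two densities on `U`
  have hn₁ : ∀ w ∈ U, 0 ≤ l₁ w := fun w hw => hF₁ (g w) (hgA w hw) _
  have hn₂ : ∀ w ∈ U, 0 ≤ l₂ w := fun w hw => hF₂ (g w) (hgA w hw) _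
  -- degenerate information at a zero: vanishing gradient and non-negative Laplacian
  have hdeg : ∀ {l : ℂ → ℝ}, ContDiffAt ℝ 2 l z → (∀ w ∈ U, 0 ≤ l w) → l z = 0 →
      fderiv ℝ l z 1 = 0 ∧ fderiv ℝ l z Complex.I = 0 ∧ 0 ≤ Δ l z := by
    intro l hl hln hl0
    have hmin : IsLocalMin l z :=
      Filter.mem_of_superset hUz fun w hw => by
        show l z ≤ l w
        rw [hl0]; exact hln w hw
    have hfz : fderiv ℝ l z = 0 := hmin.fderiv_eq_zero
    exact ⟨by simp [hfz], by simp [hfz], laplacian_nonneg_of_isLocalMin hl hmin⟩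
  have key := pointwise_sum_ineq (hn₁ z hz) (hn₂ z hz) hc (hI₁ z hz) (hI₂ z hz)
    (fun h0 => hdeg hc₁ hn₁ h0) (fun h0 => hdeg hc₂ hn₂ h0)
  rw [hlap, hfd]
  simpa only [Pi.add_apply, add_apply] using key

/-- **Sum of certificates** — registered helper form (a `∀`-statement, verbatim the ledger
signature): for fixed `J`, certificates `(J, F₁, c)`, `(J, F₂, c)` on `A` with `F₁, F₂ ≥ 0` and
`c ≥ 0` give the certificate `(J, F₁ + F₂, c/2)` on `A`. See `flatCertificate_add'`.
[Grauert–Reckziegel 1965; Kobayashi 1998, Ch. 2] -/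
theorem flatCertificate_add :
    ∀ {J : EuclideanSpace ℝ (Fin 4) → EuclideanSpace ℝ (Fin 4) →L[ℝ] EuclideanSpace ℝ (Fin 4)}
      {F₁ F₂ : EuclideanSpace ℝ (Fin 4) → EuclideanSpace ℝ (Fin 4) → ℝ} {c : ℝ}
      {A : Set (EuclideanSpace ℝ (Fin 4))}, 0 ≤ c →
      (∀ x ∈ A, ∀ v, 0 ≤ F₁ x v) → (∀ x ∈ A, ∀ v, 0 ≤ F₂ x v) →
      (∀ (U : Set ℂ) (g : ℂ → EuclideanSpace ℝ (Fin 4)), IsOpen U →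
      ContDiffOn ℝ ∞ g U →
      (∀ z ∈ U, ∀ ζ : ℂ,
        fderiv ℝ g z (Complex.I * ζ) = J (g z) (fderiv ℝ g z ζ)) →
      (∀ z ∈ U, g z ∈
        A) →
      ContDiffOn ℝ 2 (fun w => F₁ (g w) (fderiv ℝ g w 1)) U ∧
      ∀ z ∈ U, 2 * c * (F₁ (g z) (fderiv ℝ g z 1)) ^ 3 ≤
        F₁ (g z) (fderiv ℝ g z 1) * (Δ (fun w => F₁ (g w) (fderiv ℝ g w 1))) z -
          ((fderiv ℝ (fun w => F₁ (g w) (fderiv ℝ g w 1)) z 1) ^ 2 +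
            (fderiv ℝ (fun w => F₁ (g w) (fderiv ℝ g w 1)) z Complex.I) ^ 2)) →
      (∀ (U : Set ℂ) (g : ℂ → EuclideanSpace ℝ (Fin 4)), IsOpen U →
      ContDiffOn ℝ ∞ g U →
      (∀ z ∈ U, ∀ ζ : ℂ,
        fderiv ℝ g z (Complex.I * ζ) = J (g z) (fderiv ℝ g z ζ)) →
      (∀ z ∈ U, g z ∈
        A) →
      ContDiffOn ℝ 2 (fun w => F₂ (g w) (fderiv ℝ g w 1)) U ∧
      ∀ z ∈ U, 2 * c * (F₂ (g z) (fderiv ℝ g z 1)) ^ 3 ≤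
        F₂ (g z) (fderiv ℝ g z 1) * (Δ (fun w => F₂ (g w) (fderiv ℝ g w 1))) z -
          ((fderiv ℝ (fun w => F₂ (g w) (fderiv ℝ g w 1)) z 1) ^ 2 +
            (fderiv ℝ (fun w => F₂ (g w) (fderiv ℝ g w 1)) z Complex.I) ^ 2)) →
      ∀ (U : Set ℂ) (g : ℂ → EuclideanSpace ℝ (Fin 4)), IsOpen U →
      ContDiffOn ℝ ∞ g U →
      (∀ z ∈ U, ∀ ζ : ℂ,
        fderiv ℝ g z (Complex.I * ζ) = J (g z) (fderiv ℝ g z ζ)) →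
      (∀ z ∈ U, g z ∈
        A) →
      ContDiffOn ℝ 2 (fun w => (fun x v => F₁ x v + F₂ x v) (g w) (fderiv ℝ g w 1)) U ∧
      ∀ z ∈ U, 2 * (c / 2) * ((fun x v => F₁ x v + F₂ x v) (g z) (fderiv ℝ g z 1)) ^ 3 ≤
        (fun x v => F₁ x v + F₂ x v) (g z) (fderiv ℝ g z 1)
          * (Δ (fun w => (fun x v => F₁ x v + F₂ x v) (g w) (fderiv ℝ g w 1))) z -
          ((fderiv ℝ (fun w => (fun x v => F₁ x v + F₂ x v) (g w) (fderiv ℝ g w 1)) z 1) ^ 2 +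
            (fderiv ℝ (fun w => (fun x v => F₁ x v + F₂ x v) 
              (g w) (fderiv ℝ g w 1)) z Complex.I) ^ 2) :=
  fun hc hF₁ hF₂ h₁ h₂ => flatCertificate_add' hc hF₁ hF₂ h₁ h₂

end Summit.SmoothPoincare4.SmoothPoincare4.Cruxes.HyperbolicEnd.Sketch

end
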